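import Summits.Ventures.QEC.Census.CSSNormalFormSAT.CubeCover
import Summits.Ventures.QEC.Census.CSSNormalFormSAT.UnsatB8W7P01
import Summits.Ventures.QEC.Census.CSSNormalFormSAT.UnsatB8W7P02
import Summits.Ventures.QEC.Census.CSSNormalFormSAT.UnsatB8W7P03
import Summits.Ventures.QEC.Census.CSSNormalFormSAT.UnsatB8W7P04
import HarnessLib

/-!
# Cube cover of the normal-form instance `(16,5,8,7)`: tree, leaves, dispatch to the 11 leaf theorems (KERNEL-PLAN items 4/5)

`treeB8W7` is the split tree of census/type-02/css161/sat2/cubes/b8w7/tree.json; `leaves_treeB8W7` lists its leaves with unit literals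
(kernel computation); `unsat_nf16_b8_w7_of_leaf` sends each leaf to its landed LRAT theorem. With `CubeTree.exists_leaf_allTrue` and
`false_of_unsat_units` (EncodeSoundSym.lean) this refutes every Boolean matrix in normal form for `(b,w) = (8,7)`. [folklore]
-/

set_option autoImplicit false

namespace Summit.Ventures.QEC.Census.CSSNormalFormSAT

/-- The cube tree of instance `(16,5,8,7)`. (definition, data) -/
def treeB8W7 : CubeTree := (.node 32 (.node 40 (.node 48 (.node 56 (.node 64 (.node 8 (.node 2 (.leaf 0) (.leaf 1)) (.node 2 (.leaf 2) (.leaf 3))) (.leaf 4)) (.leaf 5)) (.leaf 6)) (.leaf 7)) (.node 8 (.leaf 8) (.node 48 (.leaf 9) (.leaf 10))))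

/-- Its split variables are `≥ 1`. [folklore] -/
theorem treeB8W7_wf : treeB8W7.WellFormed := by
  simp [treeB8W7, CubeTree.WellFormed]

/-- Its leaves with accumulated unit literals. [folklore] -/
theorem leaves_treeB8W7 : CubeTree.leaves treeB8W7 [] = [(0, [32, 40, 48, 56, 64, 8, 2]), (1, [32, 40, 48, 56, 64, 8, -2]), (2, [32, 40, 48, 56, 64, -8, 2]), (3, [32, 40, 48, 56, 64, -8, -2]), (4, [32, 40, 48, 56, -64]), (5, [32, 40, 48, -56]), (6, [32, 40, -48]), (7, [32, -40]), (8, [-32, 8]), (9, [-32, -8, 48]), (10, [-32, -8, -48])] := by rfl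

/-- Every leaf's sub-instance is refuted in the kernel (dispatch to the landed `unsat_nf16_b8_w7_leaf*`). [folklore] -/
theorem unsat_nf16_b8_w7_of_leaf : ∀ kl ∈ CubeTree.leaves treeB8W7 [],
    Sat.Fmla.proof (List.map (fun cl : List ℤ => cl.map Sat.Literal.ofInt) (NFEnc.cnf ⟨16, 5, 8, 7⟩ ++ kl.2.map fun l => [l])) Sat.Clause.nil := by
  intro kl hkl
  rw [leaves_treeB8W7] at hkl
  simp only [List.mem_cons, List.not_mem_nil, or_false] at hkl
  rcases hkl with h | h | h | h | h | h | h | h | h | h | h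
  · subst h; exact unsat_nf16_b8_w7_leaf0
  · subst h; exact unsat_nf16_b8_w7_leaf1
  · subst h; exact unsat_nf16_b8_w7_leaf2
  · subst h; exact unsat_nf16_b8_w7_leaf3
  · subst h; exact unsat_nf16_b8_w7_leaf4
  · subst h; exact unsat_nf16_b8_w7_leaf5
  · subst h; exact unsat_nf16_b8_w7_leaf6
  · subst h; exact unsat_nf16_b8_w7_leaf7
  · subst h; exact unsat_nf16_b8_w7_leaf8
  · subst h; exact unsat_nf16_b8_w7_leaf9
  · subst h; exact unsat_nf16_b8_w7_leaf10

end Summit.Ventures.QEC.Census.CSSNormalFormSAT
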